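import Summits.HubbardSuperconductivity.HubbardSuperconductivity.Theorems.CapRgSymmetricCertificatePinned.Negative.B1gBlind
import Summits.HubbardSuperconductivity.HubbardSuperconductivity.Theorems.CapRgSymmetricCertificatePinned.Negative.GaugeCovariance

/-!
# Crux `CapRgSymmetricCertificatePinned` (item `stmt-HubbardSuperconductivity-14045`, route
# `AposterioriCapRg`): no certificate at `U = 0` in ANY frame; diagonal Cooper amplitudes certify nothing

Negative-side support lemmas from the standing disprover (cdisprove, cycle 2, 2026-08-16; part 3b, on top
of `SchurBound.lean` / `B1gBlind.lean` and the symmetry-transport engine `GaugeCovariance.lean`).  Nothing here asserts a Theses decl.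

* §B **Support of the zero-seed CT covariance**: `hubbardCovAboveCT L M β μ 0 K Λ X Y = 0` unless `X`, `Y`
  are the two charge labels `ψ^∓` of ONE mode `(k, σ)` (`hubbardCovAboveCT_zero_seed_eq_zero`; the Nambu
  propagator is diagonal at `h = 0`), so every single-mode gauge scaling `modeGauge m₀ t`
  (`ψ⁺_{m₀} ↦ t ψ⁺_{m₀}`, `ψ⁻_{m₀} ↦ t⁻¹ ψ⁻_{m₀}`) preserves it (`modeGauge_preserves_hubbardCovAboveCT`).
* §C **The free effective action of every frame is `U(1)^{modes}`-invariant**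
  (`map_modeGauge_hubbardEffectiveActionCT_free`: at `U = 0` the interaction slot is the mode-diagonal
  counterterm `𝒩_K`, fixed by every single-mode gauge scaling, which also preserves the zero-seed CT
  covariance), hence **its Cooper amplitude is diagonal**: `𝒞(k⃗, k⃗') = 0` for `k⃗ ≠ k⃗'`
  (`cooperAmplitude_free_eq_zero_of_ne`; the Cooper label tuple has gauge weight `t⁻¹ ≠ 1` for the mode
  `((ω₀, k⃗), ↑)`).
* §C′ **Parity**: `𝒢^K_Λ` is even for every `U`, seed and frame (`map_parity_hubbardEffectiveActionCT`), so
  its odd vertex functions and their sup norms vanish (`vertexFn_hubbardCT_eq_zero_of_odd`,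
  `vertexSupNorm_hubbardCT_eq_zero_of_odd`): clause (i′b) at `m_max = 10` charges exactly `‖𝒱₆‖, ‖𝒱₈‖, ‖𝒱₁₀‖`.
* §D **A shell-diagonal Cooper amplitude certifies nothing**
  (`not_symmetricCertifiedAtT_of_cooperAmplitude_offDiag_eq_zero`, for EVERY `G`, no symmetry assumed):
  under clause (ii′)-Cooper the `B₁g` bottom `f` and its modulus `|f|` — a unit vector orthogonal to `f`
  by rotation-oddness — have the same Rayleigh quotient, so the margin-`2` condition forces `λ_d ≤ 0 < a`.
  Consequences: **`not_symmetricRegimeCertificateT_free_frame`** — `¬ symmetricRegimeCertificateT 0 μ π Θ K Λ L₀`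
  for EVERY frame `K`, chemical potential, data, tolerance, scale, threshold (the tree's junk test
  `not_symmetricRegimeCertificateT_free` is the bare frame `K = 0` only; the general frame was left open in
  `SymmetricRegimeCertificate.lean`, "NOT claimed"), and the crux-level `_false_without_` form
  `capRg_certificateHalf_false_at_free`: the certificate half `∀ Θ, ∃ K Λ L₀, symmetricRegimeCertificateT U μ π₀ Θ K Λ L₀`
  of `CapRgSymmetricCertificatePinned` is FALSE at `U = 0` for every `μ` — a proof of the crux must use
  the quartic vertex itself, in whatever frame; moving the frame cannot manufacture the window.

Sources: folklore.
-/

noncomputable section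

namespace Summit.HubbardSuperconductivity.CapRgSymmetricCertificatePinned.Negative

open Literature.MathematicalPhysics.QuantumLattice Literature.Probability.LatticeModels GrassmannAlgebra Finset Matrix
open scoped BigOperators ComplexConjugate

/-! ## §B Support of the zero-seed CT covariance; single-mode gauge scalings -/

section Support

variable {L M : ℕ}

/-- The Nambu index of `toNambu X` is the spin of `X`. [folklore] -/
theorem toNambu_fst_snd (X : HubbardFieldIdx L M) : (toNambu X).1.2 = X.1.2 := by
  unfold toNambu
  split_ifs with h
  · exact h.symm ▸ rfl
  · simp only
    -- X.1.2 ≠ 0 in Fin 2, so it is 1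
    have : X.1.2 = 1 := by
      rcases Fin.eq_zero_or_eq_succ (n := 1) X.1.2 with h0 | ⟨j, hj⟩
      · exact (h h0).elim
      · rw [hj, Fin.eq_zero j]; rfl
    exact this.symm

/-- Two labels with the same Nambu momentum–index have the same mode `(k, σ)`. [folklore] -/
theorem fst_eq_of_toNambu_fst_eq {X Y : HubbardFieldIdx L M} (h : (toNambu X).1 = (toNambu Y).1) : X.1 = Y.1 := by
  have hσ : X.1.2 = Y.1.2 := by rw [← toNambu_fst_snd X, ← toNambu_fst_snd Y, h]
  unfold toNambu at h
  by_cases hX : X.1.2 = 0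
  · have hY : Y.1.2 = 0 := hσ ▸ hX
    rw [if_pos hX, if_pos hY] at h
    exact h
  · have hY : ¬ Y.1.2 = 0 := fun hY => hX (hσ.trans hY)
    rw [if_neg hX, if_neg hY] at h
    simp only [Prod.mk.injEq, and_true] at h
    have hk : X.1.1 = Y.1.1 := by rw [← FreqMomentum.neg_neg X.1.1, h, FreqMomentum.neg_neg]
    exact Prod.ext hk hσ

/-- Within one mode, `toNambu` distinguishes the charge index. [folklore] -/
theorem toNambu_snd_ne_of {X Y : HubbardFieldIdx L M} (h1 : X.1 = Y.1) (h2 : (toNambu X).2 ≠ (toNambu Y).2) :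
    X.2 ≠ Y.2 := by
  intro h
  apply h2
  unfold toNambu
  by_cases hX : X.1.2 = 0
  · have hY : Y.1.2 = 0 := h1 ▸ hX
    rw [if_pos hX, if_pos hY, h]
  · have hY : ¬ Y.1.2 = 0 := fun hY => hX (h1.symm ▸ hY)
    rw [if_neg hX, if_neg hY]
    simp only [h]

/-- **At zero seed the CT Nambu table is diagonal in the Nambu index** (same Nambu momentum AND index). [folklore] -/
theorem nambuTwoPointCT_zero_seed_eq_zero (β μ : ℝ) (K : TrigPolyC4v)
    {X Y : (FreqMomentum L M × Fin 2) × Fin 2} (h : ¬ (X.2 = 1 ∧ Y.2 = 0 ∧ X.1 = Y.1)) :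
    nambuTwoPointCT L M β μ 0 K X Y = 0 := by
  unfold nambuTwoPointCT
  split_ifs with hc
  · obtain ⟨h1, h2, h3⟩ := hc
    have hne : X.1.2 ≠ Y.1.2 := fun hidx => h ⟨h1, h2, Prod.ext h3 hidx⟩
    have hoff : nambuPropagatorCT L M β μ 0 K X.1.1 X.1.2 Y.1.2 = 0 := by
      have key : ∀ a b : Fin 2, a ≠ b → nambuPropagatorCT L M β μ 0 K X.1.1 a b = 0 := by
        intro a b hab
        fin_cases a <;> fin_cases b
        · exact (hab rfl).elim
        · simp [nambuPropagatorCT]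
        · simp [nambuPropagatorCT]
        · exact (hab rfl).elim
      exact key _ _ hne
    rw [hoff, mul_zero]
  · rfl

/-- **Support of the zero-seed CT two-point table**: nonzero only on the two labels `ψ^±` of ONE mode. [folklore] -/
theorem hubbardTwoPointCT_zero_seed_eq_zero (β μ : ℝ) (K : TrigPolyC4v) {X Y : HubbardFieldIdx L M}
    (h : ¬ (X.1 = Y.1 ∧ X.2 ≠ Y.2)) : hubbardTwoPointCT L M β μ 0 K X Y = 0 := by
  have hXY : nambuTwoPointCT L M β μ 0 K (toNambu X) (toNambu Y) = 0 := by
    refine nambuTwoPointCT_zero_seed_eq_zero β μ K fun ⟨h1, h2, h3⟩ => h ?_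
    have hm : X.1 = Y.1 := fst_eq_of_toNambu_fst_eq h3
    exact ⟨hm, toNambu_snd_ne_of hm (by rw [h1, h2]; exact one_ne_zero)⟩
  have hYX : nambuTwoPointCT L M β μ 0 K (toNambu Y) (toNambu X) = 0 := by
    refine nambuTwoPointCT_zero_seed_eq_zero β μ K fun ⟨h1, h2, h3⟩ => h ?_
    have hm : Y.1 = X.1 := fst_eq_of_toNambu_fst_eq h3
    exact ⟨hm.symm, (toNambu_snd_ne_of hm (by rw [h1, h2]; exact one_ne_zero)).symm⟩
  rw [hubbardTwoPointCT, hXY, hYX, sub_zero]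

/-- Hence the zero-seed CT covariance above any scale is supported on pairs of labels of one mode. [folklore] -/
theorem hubbardCovAboveCT_zero_seed_eq_zero (β μ : ℝ) (K : TrigPolyC4v) (Λ : ℝ) {X Y : HubbardFieldIdx L M}
    (h : ¬ (X.1 = Y.1 ∧ X.2 ≠ Y.2)) : hubbardCovAboveCT L M β μ 0 K Λ X Y = 0 := by
  rw [hubbardCovAboveCT, Matrix.of_apply, hubbardCovarianceCT, Matrix.of_apply,
    hubbardTwoPointCT_zero_seed_eq_zero β μ K h, neg_zero, mul_zero]

end Support

section Gauge

variable {L M : ℕ}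

/-- The **single-mode gauge scaling** `ψ⁺_{m₀} ↦ t ψ⁺_{m₀}`, `ψ⁻_{m₀} ↦ t⁻¹ ψ⁻_{m₀}`, all other
generators fixed. [folklore] -/
def modeGauge (m₀ : FreqMomentum L M × Fin 2) (t : ℂ) (X : HubbardFieldIdx L M) : ℂ :=
  if X.1 = m₀ then (if X.2 = 0 then t else t⁻¹) else 1

/-- On the two charge labels of one mode the gauge weights multiply to `1`. [folklore] -/
theorem modeGauge_mul_of_mode_eq {m₀ : FreqMomentum L M × Fin 2} {t : ℂ} (ht : t ≠ 0)
    {X Y : HubbardFieldIdx L M} (h1 : X.1 = Y.1) (h2 : X.2 ≠ Y.2) :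
    modeGauge m₀ t X * modeGauge m₀ t Y = 1 := by
  unfold modeGauge
  rw [← h1]
  by_cases hm : X.1 = m₀
  · rw [if_pos hm, if_pos hm]
    have hcases : (X.2 = 0 ∧ Y.2 = 1) ∨ (X.2 = 1 ∧ Y.2 = 0) := by
      revert h2
      rcases Fin.exists_fin_two.1 ⟨X.2, rfl⟩ with hX | hX <;>
        rcases Fin.exists_fin_two.1 ⟨Y.2, rfl⟩ with hY | hY <;> simp [hX, hY]
    rcases hcases with ⟨hX, hY⟩ | ⟨hX, hY⟩
    · rw [if_pos hX, if_neg (by rw [hY]; exact one_ne_zero), mul_inv_cancel₀ ht]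
    · rw [if_neg (by rw [hX]; exact one_ne_zero), if_pos hY, inv_mul_cancel₀ ht]
  · rw [if_neg hm, if_neg hm, one_mul]

/-- **The single-mode gauge scaling preserves the zero-seed CT covariance** (every frame, every scale). [folklore] -/
theorem modeGauge_preserves_hubbardCovAboveCT (m₀ : FreqMomentum L M × Fin 2) {t : ℂ} (ht : t ≠ 0)
    (β μ : ℝ) (K : TrigPolyC4v) (Λ : ℝ) (X Y : HubbardFieldIdx L M) :
    modeGauge m₀ t X * modeGauge m₀ t Y * hubbardCovAboveCT L M β μ 0 K Λ X Y =
      hubbardCovAboveCT L M β μ 0 K Λ X Y := by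
  by_cases h : X.1 = Y.1 ∧ X.2 ≠ Y.2
  · rw [modeGauge_mul_of_mode_eq ht h.1 h.2, one_mul]
  · rw [hubbardCovAboveCT_zero_seed_eq_zero β μ K Λ h, mul_zero]

end Gauge


/-! ## §C The free effective action of a frame is gauge invariant; its Cooper amplitude is diagonal -/

section FreeAction

variable {L M : ℕ} [NeZero L]

omit [NeZero L] in
/-- The single-mode gauge scaling fixes every `ψ⁺_{kσ} ψ⁻_{kσ}`. [folklore] -/
theorem map_modeGauge_psiPlus_mul_psiMinus (m₀ : FreqMomentum L M × Fin 2) {t : ℂ} (ht : t ≠ 0)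
    (k : FreqMomentum L M) (σ : Fin 2) :
    ExteriorAlgebra.map (diagScale ℂ (modeGauge m₀ t)) (psiPlus k σ * psiMinus k σ) = psiPlus k σ * psiMinus k σ := by
  rw [map_mul, psiPlus, psiMinus, map_diagScale_gen, map_diagScale_gen, smul_mul_smul_comm,
    modeGauge_mul_of_mode_eq ht (X := ((k, σ), 0)) (Y := ((k, σ), 1)) rfl (by exact zero_ne_one), one_smul]

/-- The single-mode gauge scaling fixes the quadratic counterterm `𝒩_K` of every frame. [folklore] -/
theorem map_modeGauge_counterQuadratic (m₀ : FreqMomentum L M × Fin 2) {t : ℂ} (ht : t ≠ 0) (β : ℝ)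
    (K : TrigPolyC4v) :
    ExteriorAlgebra.map (diagScale ℂ (modeGauge m₀ t)) (counterQuadratic L M β K) = counterQuadratic L M β K := by
  simp only [counterQuadratic, map_sum, map_smul, map_modeGauge_psiPlus_mul_psiMinus m₀ ht]

/-- At `U = 0` the interaction slot of the frame `K` is the counterterm alone: `V_K = 𝒩_K`. [folklore] -/
theorem hubbardInteractionCT_free (β : ℝ) (K : TrigPolyC4v) :
    hubbardInteractionCT L M β 0 K = counterQuadratic L M β K := by
  have h : hubbardInteraction L M β 0 = 0 := by simp [hubbardInteraction]
  rw [hubbardInteractionCT, h, zero_add]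

/-- **Gauge invariance of the free effective action in every frame**: at `U = 0`, `𝒢^K_Λ` at zero seed is
fixed by EVERY single-mode gauge scaling `ψ^±_{m₀} ↦ t^{±1} ψ^±_{m₀}` (`U(1)^{modes}` symmetry). [folklore] -/
theorem map_modeGauge_hubbardEffectiveActionCT_free (m₀ : FreqMomentum L M × Fin 2) {t : ℂ} (ht : t ≠ 0)
    (β μ : ℝ) (K : TrigPolyC4v) (Λ : ℝ) :
    ExteriorAlgebra.map (diagScale ℂ (modeGauge m₀ t)) (hubbardEffectiveActionCT L M β 0 μ 0 K Λ) =
      hubbardEffectiveActionCT L M β 0 μ 0 K Λ := by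
  rw [hubbardEffectiveActionCT]
  refine map_diagScale_effAction ℂ (modeGauge_preserves_hubbardCovAboveCT m₀ ht β μ K Λ)
    (isNilpotent_hubbardInteractionCT L M β 0 K) ?_
  rw [hubbardInteractionCT_free, map_modeGauge_counterQuadratic m₀ ht]

variable [NeZero M]

/-- **The free Cooper amplitude is diagonal in every frame**: at `U = 0`, `𝒞(k⃗, k⃗') = 0` for `k⃗ ≠ k⃗'`
(the Cooper label tuple carries gauge weight `t⁻¹ ≠ 1` for the mode `((ω₀, k⃗), ↑)`). [folklore] -/
theorem cooperAmplitude_free_eq_zero_of_ne (β μ : ℝ) (K : TrigPolyC4v) (Λ : ℝ) {k k' : TorusSite 2 L}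
    (hkk' : k ≠ k') :
    cooperAmplitude L M β (hubbardEffectiveActionCT L M β 0 μ 0 K Λ) k k' = 0 := by
  have hinv := map_modeGauge_hubbardEffectiveActionCT_free (L := L) (M := M) ((omega0 M, k), 0)
    (t := 2) two_ne_zero β μ K Λ
  have hker : kernel ℂ (hubbardEffectiveActionCT L M β 0 μ 0 K Λ) 4
      ![(((omega0 M, k'), 0), 0), ((FreqMomentum.neg (omega0 M, k'), 1), 0),
        ((FreqMomentum.neg (omega0 M, k), 1), 1), (((omega0 M, k), 0), 1)] = 0 := by
    refine kernel_eq_zero_of_map_diagScale_eq ℂ hinv ?_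
    rw [isUnit_iff_ne_zero, Fin.prod_univ_four]
    have h0 : modeGauge ((omega0 M, k), 0) (2 : ℂ) (((omega0 M, k'), 0), 0) = 1 := by
      unfold modeGauge
      rw [if_neg]
      simp only [Prod.mk.injEq, and_true]
      exact fun h => hkk' h.2.symm
    have h1 : modeGauge ((omega0 M, k), 0) (2 : ℂ) ((FreqMomentum.neg (omega0 M, k'), 1), 0) = 1 := by
      unfold modeGauge
      rw [if_neg]
      simp only [Prod.mk.injEq, one_ne_zero, and_false, not_false_eq_true]
    have h2 : modeGauge ((omega0 M, k), 0) (2 : ℂ) ((FreqMomentum.neg (omega0 M, k), 1), 1) = 1 := by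
      unfold modeGauge
      rw [if_neg]
      simp only [Prod.mk.injEq, one_ne_zero, and_false, not_false_eq_true]
    have h3 : modeGauge ((omega0 M, k), 0) (2 : ℂ) (((omega0 M, k), 0), 1) = 2⁻¹ := by
      unfold modeGauge
      rw [if_pos rfl, if_neg (by exact one_ne_zero)]
    simp only [Matrix.cons_val_zero, Matrix.cons_val_one, Matrix.cons_val_two, Matrix.cons_val_three,
      Matrix.head_cons, Matrix.tail_cons, h0, h1, h2, h3]
    norm_num
  rw [cooperAmplitude, vertexFn, hker, mul_zero]

end FreeAction


/-! ## §C′ Parity: the countertermed effective action is even, so its odd vertex functions vanish -/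

section Parity

variable {L M : ℕ} [NeZero L]

/-- The Hubbard vertex is even: fixed by the parity scaling `ψ ↦ -ψ`. [folklore] -/
theorem map_parity_hubbardInteraction (β U : ℝ) :
    ExteriorAlgebra.map (diagScale ℂ (fun _ : HubbardFieldIdx L M => (-1 : ℂ))) (hubbardInteraction L M β U) =
      hubbardInteraction L M β U := by
  unfold hubbardInteraction
  simp only [map_smul, map_sum, apply_ite (ExteriorAlgebra.map (diagScale ℂ fun _ : HubbardFieldIdx L M => (-1 : ℂ))),
    map_mul, map_zero, psiPlus, psiMinus, map_diagScale_gen, neg_one_smul, neg_mul, mul_neg, neg_neg]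

/-- The counterterm of every frame is even. [folklore] -/
theorem map_parity_counterQuadratic (β : ℝ) (K : TrigPolyC4v) :
    ExteriorAlgebra.map (diagScale ℂ (fun _ : HubbardFieldIdx L M => (-1 : ℂ))) (counterQuadratic L M β K) =
      counterQuadratic L M β K := by
  unfold counterQuadratic
  simp only [map_sum, map_smul, map_mul, psiPlus, psiMinus, map_diagScale_gen, neg_one_smul, neg_mul, mul_neg,
    neg_neg]

/-- **The countertermed effective action is even** (every `U`, `μ`, seed `h`, frame, scale): it is fixed by the
parity scaling `ψ(X) ↦ -ψ(X)`, which preserves every covariance. [folklore] -/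
theorem map_parity_hubbardEffectiveActionCT (β U μ h : ℝ) (K : TrigPolyC4v) (Λ : ℝ) :
    ExteriorAlgebra.map (diagScale ℂ (fun _ : HubbardFieldIdx L M => (-1 : ℂ))) (hubbardEffectiveActionCT L M β U μ h K Λ) =
      hubbardEffectiveActionCT L M β U μ h K Λ := by
  rw [hubbardEffectiveActionCT]
  refine map_diagScale_effAction ℂ (fun X Y => by ring) (isNilpotent_hubbardInteractionCT L M β U K) ?_
  rw [hubbardInteractionCT, map_add, map_parity_hubbardInteraction, map_parity_counterQuadratic]

/-- **Odd vertex functions of the countertermed effective action vanish** (so clause (i′b) at `m_max = 10`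
charges exactly `‖𝒱₆‖, ‖𝒱₈‖, ‖𝒱₁₀‖`). [folklore] -/
theorem vertexFn_hubbardCT_eq_zero_of_odd (β U μ h : ℝ) (K : TrigPolyC4v) (Λ : ℝ) {m : ℕ} (hm : Odd m)
    (X : Fin m → HubbardFieldIdx L M) :
    vertexFn L M β (hubbardEffectiveActionCT L M β U μ h K Λ) m X = 0 := by
  have hker : kernel ℂ (hubbardEffectiveActionCT L M β U μ h K Λ) m X = 0 := by
    refine kernel_eq_zero_of_map_diagScale_eq ℂ (map_parity_hubbardEffectiveActionCT β U μ h K Λ) ?_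
    rw [Finset.prod_const, Finset.card_univ, Fintype.card_fin, hm.neg_one_pow, isUnit_iff_ne_zero]
    norm_num
  rw [vertexFn, hker, mul_zero]

/-- The sup norms of the odd vertex functions vanish. [folklore] -/
theorem vertexSupNorm_hubbardCT_eq_zero_of_odd (β U μ h : ℝ) (K : TrigPolyC4v) (Λ : ℝ) {m : ℕ} (hm : Odd m) :
    vertexSupNorm L M β (hubbardEffectiveActionCT L M β U μ h K Λ) m = 0 := by
  simp only [vertexSupNorm, vertexFn_hubbardCT_eq_zero_of_odd β U μ h K Λ hm, norm_zero, Real.iSup_const_zero]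

end Parity

/-! ## §D Diagonal Cooper amplitudes certify nothing; no certificate at `U = 0` in any frame -/

section Diagonal

variable {L M : ℕ} [NeZero L] [NeZero M]

/-- For a matrix with vanishing off-diagonal entries, `⟨v, A v⟩ = Σ_k A_kk |v_k|²`. [folklore] -/
theorem star_dotProduct_mulVec_of_offDiag_eq_zero {A : Matrix (TorusSite 2 L) (TorusSite 2 L) ℂ}
    (hA : ∀ k k', k ≠ k' → A k k' = 0) (v : TorusSite 2 L → ℂ) :
    star v ⬝ᵥ (A *ᵥ v) = ∑ k, A k k * ((‖v k‖ ^ 2 : ℝ) : ℂ) := by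
  unfold dotProduct
  refine Finset.sum_congr rfl fun k _ => ?_
  have hk : (A *ᵥ v) k = A k k * v k := by
    rw [Matrix.mulVec, dotProduct, Finset.sum_eq_single k (fun k' _ hk' => by rw [hA k k' (Ne.symm hk'), zero_mul])
      (fun h => (h (Finset.mem_univ k)).elim)]
  rw [hk, Pi.star_apply, Complex.star_def, Complex.ofReal_pow, ← Complex.conj_mul']
  ring

/-- **A shell-diagonal Cooper amplitude certifies nothing.**  If `𝒞(k⃗, k⃗') = 0` for all `k⃗ ≠ k⃗'` on the
shell, then under clause (ii′)-Cooper the `B₁g` bottom `f` and its modulus `|f|` (a unit vector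
ORTHOGONAL to `f`, by rotation-oddness) have the same Rayleigh quotient, so the margin-`2` condition
forces `λ_d ≤ 0`: no interval with `a > 0` certifies `G` — whatever the data, band, scale, normaliser.
(No symmetry of `G` is needed.) [folklore] -/
theorem not_symmetricCertifiedAtT_of_cooperAmplitude_offDiag_eq_zero {π : SymmetricRegimeDataT}
    {Θ : SymmetricTolerance} {a b : ℚ} (ha : 0 < a) {Λ β : ℝ} {e : TorusSite 2 L → ℝ}
    {G : HubbardGrassmann L M} {Z : ℂ}
    (h0 : ∀ k ∈ momentumShell L e Λ, ∀ k' ∈ momentumShell L e Λ, k ≠ k' → cooperAmplitude L M β G k k' = 0) :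
    ¬ SymmetricCertifiedAtT π Θ a b Λ L M β e G Z := by
  intro h
  obtain ⟨f, hf1, hB, hbot, hmargin⟩ := h.cooperDominance
  have hwin := h.window.1
  set A := cooperMatrix L M β e Λ G with hAdef
  -- the Cooper matrix has no off-diagonal entries
  have hA : ∀ k k', k ≠ k' → A k k' = 0 := fun k k' hkk' => by
    rw [hAdef, cooperMatrix, Matrix.of_apply]
    split_ifs with hS
    · rw [h0 k hS.1 k' hS.2 hkk', mul_zero, zero_mul]
    · rfl
  -- the modulus of the `B₁g` bottom
  let g : TorusSite 2 L → ℂ := fun k => ((‖f k‖ : ℝ) : ℂ)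
  have hg1 : star g ⬝ᵥ g = 1 := by
    have h1 := sum_norm_sq_eq_one_of_unit hf1
    simp only [dotProduct, Pi.star_apply, g, Complex.star_def, Complex.conj_ofReal, ← sq]
    exact_mod_cast h1
  have hfg : star f ⬝ᵥ g = 0 := by
    have hodd : ∀ k, (fun k => conj (f k) * ((‖f k‖ : ℝ) : ℂ)) (rotSite k) =
        -(fun k => conj (f k) * ((‖f k‖ : ℝ) : ℂ)) k := fun k => by
      simp only [rot_odd_of_isB1g hB k, map_neg, norm_neg]
      ring
    have hsum := sum_sqrt_mul_eq_zero_of_rot_odd (Finset.univ : Finset (TorusSite 2 L)) (fun _ => (1 : ℝ))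
      (fun k => conj (f k) * ((‖f k‖ : ℝ) : ℂ)) (fun k => by simp) (fun _ => rfl) hodd
    simp only [Real.sqrt_one, Complex.ofReal_one, one_mul] at hsum
    simpa only [dotProduct, Pi.star_apply, Complex.star_def, g] using hsum
  -- `f` and `|f|` have the same Rayleigh quotient
  have hre : reRayleigh A g = reRayleigh A f := by
    simp only [reRayleigh, star_dotProduct_mulVec_of_offDiag_eq_zero hA, g, Complex.norm_real, norm_norm]
  have hm := hmargin g hg1 hfg
  rw [hre, hbot] at hm
  have hpos : (0 : ℝ) < (-A).supRayleigh := by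
    have : (0 : ℝ) < a := by exact_mod_cast ha
    exact lt_of_lt_of_le this hwin
  have h2 : (symmetricCooperMargin : ℝ) = 2 := by norm_num [symmetricCooperMargin]
  rw [h2] at hm
  linarith

/-- **No certificate at `U = 0`, in ANY frame**: for every chemical potential, data, tolerance, frame
`K`, scale and threshold, `symmetricRegimeCertificateT 0 μ π Θ K Λ L₀` is FALSE — the free effective
action of the frame `K` has a diagonal Cooper amplitude (`cooperAmplitude_free_eq_zero_of_ne`), which
certifies nothing.  (The tree's junk test `not_symmetricRegimeCertificateT_free` is the bare frame
`K = 0`; this is the general frame, left open in `SymmetricRegimeCertificate.lean`, "NOT claimed".)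
So the hypothesis `U ∈ [2, 3]` of the crux is load-bearing beyond `U ≠ 0` bookkeeping: a proof must
use the quartic vertex. [folklore] -/
theorem not_symmetricRegimeCertificateT_free_frame (μ : ℝ) (π : SymmetricRegimeDataT) (Θ : SymmetricTolerance)
    (K : TrigPolyC4v) (Λ : ℝ) (L₀ : ℕ) : ¬ symmetricRegimeCertificateT 0 μ π Θ K Λ L₀ := by
  intro h
  obtain ⟨a, b, ha, -, -, hblock⟩ := SymmetricRegimeHoldsT.exists_window h
  haveI : NeZero (L₀ + 1) := ⟨Nat.succ_ne_zero _⟩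
  obtain ⟨β₀, hβ₀⟩ := hblock (L₀ + 1) (Nat.le_succ _)
  obtain ⟨M₀, hM₀⟩ := hβ₀ β₀ le_rfl
  haveI : NeZero (M₀ + 1) := ⟨Nat.succ_ne_zero _⟩
  have hc : SymmetricCertifiedAtT π Θ a b Λ (L₀ + 1) (M₀ + 1) β₀ (nambuXiCT (L₀ + 1) μ K)
      (hubbardEffectiveActionCT (L₀ + 1) (M₀ + 1) β₀ 0 μ 0 K Λ)
      (hubbardEffPartitionFnCT (L₀ + 1) (M₀ + 1) β₀ 0 μ 0 K Λ) := hM₀ (M₀ + 1) (Nat.le_succ _)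
  exact not_symmetricCertifiedAtT_of_cooperAmplitude_offDiag_eq_zero ha
    (fun k _ k' _ hkk' => cooperAmplitude_free_eq_zero_of_ne β₀ μ K Λ hkk') hc

/-- **Crux-level form (`_false_without_` the coupling interval)**: the certificate half of
`CapRgSymmetricCertificatePinned` — `∀ Θ, ∃ K Λ L₀, symmetricRegimeCertificateT U μ π₀ Θ K Λ L₀` — is
FALSE at `U = 0` for every `μ`; the natural strengthening of the crux to the coupling range `[0, 3]`
pinned at its left end fails, and any proof of the crux must exploit `U > 0` through the quartic
vertex itself (not only through `λ_d ≠ 0` in the bare frame). [folklore] -/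
theorem capRg_certificateHalf_false_at_free (μ : ℝ) :
    ¬ ∀ Θ : SymmetricTolerance, ∃ (K : TrigPolyC4v) (Λ : ℝ) (L₀ : ℕ),
      symmetricRegimeCertificateT 0 μ capRgCornerDataT Θ K Λ L₀ := by
  intro h
  obtain ⟨K, Λ, L₀, hK⟩ := h ⟨1, one_pos, 1, one_pos⟩
  exact not_symmetricRegimeCertificateT_free_frame μ capRgCornerDataT _ K Λ L₀ hK

end Diagonal

end Summit.HubbardSuperconductivity.CapRgSymmetricCertificatePinned.Negative

end
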